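import Literature.MathematicalPhysics.StatisticalMechanics.HardSphereContactTheorem
import Literature.MathematicalPhysics.KineticTheory.HardSphereEulerLLN
import HarnessLib

/-!
# Statics programme for the `t = 0` twin of T34p (crux stmt-AtomisticToContinuum-13481 `CollisionRate`, line `Sketch`)

Lead c9 (prover-line-stmt-AtomisticToContinuum-13481-c9-0), 2026-08-17.  A TYPED PROGRAMME, not a proposal and not a stub: the two
Literature-class static facts that a Lean proof of the `t = 0` instance of the promoted kinetic stub T34p
(`Stubs.stub_evenTubeTimeStatProbLG`, equivalently of its one-time `L¹` form `E_LG |W_0| → 0`) for INHOMOGENEOUS local Gibbs profiles would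
consume, stated in the tree's vocabulary so that a planner can file them (topic `Literature/MathematicalPhysics/StatisticalMechanics`,
story `HardSphereContactTheorem`) and a prover can discharge them from the tree's inhomogeneous canonical cluster expansion
(`KineticTheory/HardSphereEulerLLN`: `tendsto_onePt`, `tendsto_twoPt` at MACROSCOPIC scale) combined with the contact-scale machinery of
the HOMOGENEOUS contact theorem (`StatisticalMechanics/HardSphereContactTheoremProofs`: Kirkwood–Salsburg limit `gLim`, virial identity,
`contactValue_eq_contactG`).  Audit of lead c8 (paper, `Lines/Sketch.md` §"t = 0 audit"): with these two facts the rung-0 proof of R34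
(`Theorems.CollisionRate.stub_evenTubeStatL1Rung0`: tube mean at the contact value, Enskog mean by dominated convergence, variance by
four-point decorrelation) ports to `t = 0` for general profiles, the difference of the two means being `O(ω(r))` in the moduli of
continuity of `ρ₀, u₀, θ₀` — it vanishes as `r → 0`, consistently with T34p's quantifier order (`∃ r₀` after the profiles).

Normalisation check (definitional, below): at `a₀ ≡ 1`, `χ ≡ 1` fact (F1) is VERBATIM the homogeneous `HardSphereContactTheorem` with
`ρ₀ ≡ 1` (`example` at the end: the homogeneous theorem is the `a₀ ≡ 1, χ ≡ 1, ρ₀ ≡ 1` instance of the inhomogeneous text, up to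
`1 ^ 2 * Y = Y` and `∫ 1 = 1`, checked by `simp`).

Size: XL (inhomogeneous Kirkwood–Salsburg analysis at contact scale with a slowly varying activity; the macroscopic-scale part exists).
Value: sanity twin of the promoted item (its `t = 0` slice for general data), reusable by every route that reads a collision functional
at `t = 0` (entropy-method routes, `TendstoHydroFieldsAt … 0` consumers).  NOT on the critical path of the crux (T34p at `t > 0` is the
open core regardless).
-/

noncomputable section

namespace Summit.AtomisticToContinuum.HydrodynamicLimit.Cruxes.CollisionRate.StaticsProgramme

open MeasureTheory Filter Set
open scoped ENNReal Pointwise Topology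
open Literature.Analysis.FluidPDE Literature.MathematicalPhysics.KineticTheory Literature.MathematicalPhysics.StatisticalMechanics

/-- **(F1) · THE CONTACT THEOREM FOR THE INHOMOGENEOUS CANONICAL HARD-SPHERE GAS ON `𝕋³` AT LOW DENSITY** (candidate named fact).  For a
continuous activity profile `a₀ > 0` and small reduced density `σ < σ₁(a₀)` there is a continuous positive limit density `ρ₀`
(`∫ ρ₀ = 1`; the `rhoLim` of `HardSphereEulerLLN`, identified here by the density LLN it satisfies) such that, for every continuous
localiser `χ` and relative error `ζ`, on thin shells `{1 < ‖q‖ ≤ 1 + δ}` (`δ ≤ δ₁(ζ)`, then `N ≥ N₀`), uniformly over measurable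
`S` in the shell and labels `i ≠ j`:
`|E[χ(x_i) 𝟙{ε⁻¹ reprSym(x_i − x_j) ∈ S}] − ε³ vol(S) ∫ χ ρ₀² Y(σ³ρ₀)| ≤ ζ ε³ vol(S)`, `ε = hsDiameter σ N`, `Y = contactValue` — the
rescaled near-contact pair law is LOCALLY the homogeneous one at the local reduced density `σ³ρ₀(x)` (local virial / contact theorem).
[cite: HansenMcdonald2013, §2.5; PulvirentiTsagkarogiannis2012, Thm 2.1] -/
def HardSphereContactTheoremInhomogeneous : Prop :=
    ∀ a₀ : T3 → ℝ, Continuous a₀ → (∀ x, 0 < a₀ x) →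
      ∃ σ₁ : ℝ, 0 < σ₁ ∧ ∀ σ : ℝ, 0 < σ → σ < σ₁ →
      ∃ ρ₀ : T3 → ℝ, Continuous ρ₀ ∧ (∀ x, 0 < ρ₀ x) ∧
        (∀ χ : T3 → ℝ, Continuous χ → ∀ δ > (0 : ℝ),
          Tendsto (fun N : ℕ => posGibbsMeasure a₀ (hsDiameter σ N) (N + 1)
            {x | δ < |((N + 1 : ℕ) : ℝ)⁻¹ * ∑ i, χ (x i) - ∫ y, χ y * ρ₀ y|}) atTop (𝓝 0)) ∧
        ∀ χ : T3 → ℝ, Continuous χ → ∀ ζ : ℝ, 0 < ζ → ∃ δ₁ : ℝ, 0 < δ₁ ∧ ∀ δ : ℝ, 0 < δ → δ ≤ δ₁ →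
          ∃ N₀ : ℕ, ∀ N : ℕ, N₀ ≤ N → ∀ i j : Fin (N + 1), i ≠ j →
            ∀ S : Set V3, MeasurableSet S → S ⊆ {q | 1 < ‖q‖ ∧ ‖q‖ ≤ 1 + δ} →
              |∫ x, χ (x i) * ({x | Torus.reprSym (x i - x j) ∈ hsDiameter σ N • S}.indicator (fun _ => (1 : ℝ)) x)
                    ∂(posGibbsMeasure a₀ (hsDiameter σ N) (N + 1))
                  - hsDiameter σ N ^ 3 * (volume S).toReal * ∫ y, χ y * (ρ₀ y ^ 2 * contactValue (σ ^ 3 * ρ₀ y))|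
                ≤ ζ * hsDiameter σ N ^ 3 * (volume S).toReal

/-- **(F2) · FOUR-POINT DECORRELATION AT CONTACT SCALE for the inhomogeneous canonical gas** (candidate named fact; inhomogeneous twin of
`KineticTheory/HardSphereCanonicalTwoCluster(Limit)` read at contact scale).  Same data as (F1); for label pairs `{i, j} ∩ {k, l} = ∅`
the two localised near-contact pair events decorrelate to relative order `ζ`:
`|E[χ(x_i)𝟙_{ij ∈ εS} · χ'(x_k)𝟙_{kl ∈ εS'}] − E[χ(x_i)𝟙_{ij ∈ εS}] · E[χ'(x_k)𝟙_{kl ∈ εS'}]| ≤ ζ ε⁶ vol(S) vol(S')`.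
(Shared-label terms of the tube-count variance need only the Ruelle envelope at `t = 0`, a tree theorem:
`Theorems.CollisionRate.stub_lanfordEnvelopeR_initial`.) [cite: PulvirentiTsagkarogiannis2015, §2] -/
def HardSphereContactDecorrelationInhomogeneous : Prop :=
    ∀ a₀ : T3 → ℝ, Continuous a₀ → (∀ x, 0 < a₀ x) →
      ∃ σ₁ : ℝ, 0 < σ₁ ∧ ∀ σ : ℝ, 0 < σ → σ < σ₁ →
        ∀ χ χ' : T3 → ℝ, Continuous χ → Continuous χ' → ∀ ζ : ℝ, 0 < ζ → ∃ δ₁ : ℝ, 0 < δ₁ ∧ ∀ δ : ℝ, 0 < δ → δ ≤ δ₁ →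
          ∃ N₀ : ℕ, ∀ N : ℕ, N₀ ≤ N → ∀ i j k l : Fin (N + 1), i ≠ j → k ≠ l → i ≠ k → i ≠ l → j ≠ k → j ≠ l →
            ∀ S S' : Set V3, MeasurableSet S → MeasurableSet S' →
              S ⊆ {q | 1 < ‖q‖ ∧ ‖q‖ ≤ 1 + δ} → S' ⊆ {q | 1 < ‖q‖ ∧ ‖q‖ ≤ 1 + δ} →
              |∫ x, (χ (x i) * {x | Torus.reprSym (x i - x j) ∈ hsDiameter σ N • S}.indicator (fun _ => (1 : ℝ)) x) *
                      (χ' (x k) * {x | Torus.reprSym (x k - x l) ∈ hsDiameter σ N • S'}.indicator (fun _ => (1 : ℝ)) x)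
                    ∂(posGibbsMeasure a₀ (hsDiameter σ N) (N + 1))
                  - (∫ x, χ (x i) * {x | Torus.reprSym (x i - x j) ∈ hsDiameter σ N • S}.indicator (fun _ => (1 : ℝ)) x
                      ∂(posGibbsMeasure a₀ (hsDiameter σ N) (N + 1))) *
                    (∫ x, χ' (x k) * {x | Torus.reprSym (x k - x l) ∈ hsDiameter σ N • S'}.indicator (fun _ => (1 : ℝ)) x
                      ∂(posGibbsMeasure a₀ (hsDiameter σ N) (N + 1)))|
                ≤ ζ * hsDiameter σ N ^ 6 * (volume S).toReal * (volume S').toReal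

/-- **Normalisation check.**  The integrand of (F1) at `χ ≡ 1` is the indicator of the pair event, so its integral is the `.real`
measure of the event appearing in the homogeneous `HardSphereContactTheorem`; and at `ρ₀ ≡ 1` the Enskog-side constant is
`∫ 1 * (1 ^ 2 * Y(σ³ · 1)) = Y(σ³)`. [folklore] -/
example (σ : ℝ) (N : ℕ) (i j : Fin (N + 1)) (S : Set V3) (a₀ : T3 → ℝ)
    (hE : MeasurableSet {x : Fin (N + 1) → T3 | Torus.reprSym (x i - x j) ∈ hsDiameter σ N • S}) :
    ∫ x, (fun _ => (1 : ℝ)) (x i) * ({x | Torus.reprSym (x i - x j) ∈ hsDiameter σ N • S}.indicator (fun _ => (1 : ℝ)) x)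
        ∂(posGibbsMeasure a₀ (hsDiameter σ N) (N + 1)) =
      (posGibbsMeasure a₀ (hsDiameter σ N) (N + 1)).real {x | Torus.reprSym (x i - x j) ∈ hsDiameter σ N • S} := by
  simp only [one_mul]
  rw [show (fun _ : Fin (N + 1) → T3 => (1 : ℝ)) = 1 from rfl, integral_indicator_one hE]

example (σ : ℝ) : ∫ _y : T3, (1 : ℝ) * ((1 : ℝ) ^ 2 * contactValue (σ ^ 3 * 1)) = contactValue (σ ^ 3) := by
  simp

end Summit.AtomisticToContinuum.HydrodynamicLimit.Cruxes.CollisionRate.StaticsProgramme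

end
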